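import Summits.Parity.GeneralizedHardyLittlewood.Theorems.GreenTaoLevelTwoMNTwoVerticalApproximation
import HarnessLib

/-!
# Route `GreenTaoLevelTwo`, crux `MNTwo` (stmt-Parity-21276), line `birth`: the quantitative
# vertical approximation (`happrox`) along a central frame (core of `stub_verticalReduction`, VIII)

The harmonic-analysis layer of Green–Tao 2012a Lemma 3.7 in the exact shape consumed by the
bookkeeping lemma `…VerticalReductionBookkeeping.mnAt_of_verticalPoly_of_approx`: along a central
frame `ι : ℝ^I ↠ Z(G)` of a nilmanifold `Y` (translations `L`-Lipschitz, displacement `≤ L‖t‖`)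
there are an exponent `D` and functions `Φ, Λ` such that every `1`-bounded `M`-Lipschitz `F`
(`M ≥ 1`) is, for every `0 < ε ≤ 1`, uniformly within `ε` of a sum of at most `Φ(M)/ε^D`
vertical characters `F₁ⱼ + iF₂ⱼ` (weights `1`), each `1`-bounded, `Λ(M) = L³M`-Lipschitz and
transforming under the centre by a character (`happrox_of_frame`).  Parameters: smoothing scale
`r = ε / (4 M L (1+L))`, truncation box `[-K, K]^I` with `K = ⌈Q²⌉`,
`Q = 4|I| A^(|I|-1) Z / (π² r² ε)`; the count `(2K+1)^|I|` is bounded by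
`Φ₀ (M/ε)^((4(|I|-1)+6)|I|)`.

References: B. Green, T. Tao, *The Möbius function is strongly orthogonal to nilsequences*,
Ann. of Math. 175 (2012), Lemma 3.7 and App. A [GreenTao2012Mobius].
-/

noncomputable section

open MeasureTheory
open Literature.NumberTheory.Sieve
open Summit.Parity.GeneralizedHardyLittlewood.GreenTaoLevelTwoMNTwoVerticalApproximation

namespace Summit.Parity.GeneralizedHardyLittlewood.GreenTaoLevelTwoMNTwoVerticalHapprox

variable {s : ℕ} (Y : Nilmanifold s) {I : Type} [Fintype I] [DecidableEq I] (ι : (I → ℝ) → Y.G)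

/-! ### §1 Counting the box -/

/-- `#[-K, K]^I = (2K+1)^|I|`. [folklore] -/
theorem card_box (K : ℕ) :
    ((Fintype.piFinset fun _ : I => Finset.Icc (-(K : ℤ)) K).card : ℝ) = (2 * (K : ℝ) + 1) ^ Fintype.card I := by
  rw [Fintype.card_piFinset, Finset.prod_const, Finset.card_univ]
  push_cast
  congr 1
  rw [Int.card_Icc]
  have : ((K : ℤ) + 1 - -(K : ℤ)).toNat = 2 * K + 1 := by omega
  rw [this]
  push_cast
  ring

/-- Elementary: for `u ≥ 1`, `1 + b u² ≤ (1 + b) u²`. [folklore] -/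
theorem one_add_mul_sq_le {u : ℝ} (b : ℝ) (hu : 1 ≤ u) : 1 + b * u ^ 2 ≤ (1 + b) * u ^ 2 := by
  nlinarith [hu, sq_nonneg u]

/-! ### §2 The quantitative approximation -/

set_option maxHeartbeats 1600000 in
/-- **`happrox` along a central frame** (Green–Tao 2012a Lemma 3.7, quantitative form consumed by
`mnAt_of_verticalPoly_of_approx`). [cite: GreenTao2012Mobius, Lemma 3.7 and App. A] -/
theorem happrox_of_frame (hadd : ∀ t u, ι (t + u) = ι t * ι u)
    (hcen : ∀ t, ι t ∈ Subgroup.center Y.G) (hsurj : ∀ z ∈ Subgroup.center Y.G, ∃ t, ι t = z)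
    (hΓ : ∀ n : I → ℤ, ι (fun i => (n i : ℝ)) ∈ Y.Γ) (hcont : Continuous ι) {L : ℝ} (hL : 0 < L)
    (hlip : ∀ (t : I → ℝ) (p q : Y.G ⧸ Y.Γ), Y.dist (ι t • p) (ι t • q) ≤ L * Y.dist p q)
    (hself : ∀ (t : I → ℝ) (p : Y.G ⧸ Y.Γ), Y.dist (ι t • p) p ≤ L * ‖t‖) :
    ∃ (D : ℕ) (Φ Λ : ℝ → ℝ), ∀ (M ε : ℝ), 1 ≤ M → 0 < ε → ε ≤ 1 → ∀ F : Y.G ⧸ Y.Γ → ℝ,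
      Y.IsBoundedLipschitz M F →
        ∃ (n : ℕ) (w : Fin n → ℂ) (F₁ F₂ : Fin n → Y.G ⧸ Y.Γ → ℝ),
          (n : ℝ) ≤ Φ M / ε ^ D ∧ (∀ j, ‖w j‖ ≤ 1) ∧
          (∀ j, Y.IsBoundedLipschitz (Λ M) (F₁ j)) ∧ (∀ j, Y.IsBoundedLipschitz (Λ M) (F₂ j)) ∧
          (∀ j, (∃ θ : Y.G → ℝ, ∀ z : Y.G, z ∈ Subgroup.center Y.G → ∀ x : Y.G ⧸ Y.Γ,
          (((F₁ j) (z • x) : ℂ) + ((F₂ j) (z • x) : ℂ) * Complex.I) =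
            Complex.exp (2 * Real.pi * Complex.I * θ z) * (((F₁ j) x : ℂ) + ((F₂ j) x : ℂ) * Complex.I))) ∧
          ∀ x, ‖(F x : ℂ) - ∑ j, w j * ((F₁ j x : ℂ) + (F₂ j x : ℂ) * Complex.I)‖ ≤ ε := by
  -- constants depending on `L`, `|I|`, `Z` only
  set Zc : ℝ := (∑' k : ℤ, |(k : ℝ)| ^ (-(3 / 2 : ℝ))) with hZc
  have hZ0 : 0 ≤ Zc := tsum_nonneg fun k => Real.rpow_nonneg (abs_nonneg _) _
  set c₁ : ℝ := 4 * L * (1 + L) with hc₁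
  have hc₁0 : 0 < c₁ := by positivity
  set a₀ : ℝ := 1 + Zc * c₁ ^ 2 / Real.pi ^ 2 with ha₀
  have ha₀1 : 1 ≤ a₀ := le_add_of_nonneg_right (by positivity)
  set cI : ℕ := Fintype.card I with hcI
  set q₀ : ℝ := 4 * cI * a₀ ^ (cI - 1) * Zc * c₁ ^ 2 / Real.pi ^ 2 with hq₀
  have hq₀0 : 0 ≤ q₀ := by positivity
  set e₁ : ℕ := 2 * (cI - 1) + 3 with he₁
  refine ⟨2 * e₁ * cI, fun M => (2 * (q₀ ^ 2 + 2)) ^ cI * M ^ (2 * e₁ * cI),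
    fun M => L * (L * (L * M)), ?_⟩
  intro M ε hM1 hε0 hε1 F hF
  have hM0 : 0 ≤ M := zero_le_one.trans hM1
  have hM0' : 0 < M := zero_lt_one.trans_le hM1
  -- the scale `r`, and `u = M/ε`
  set u : ℝ := M / ε with hu
  have hu1 : 1 ≤ u := by rw [hu, le_div_iff₀ hε0]; linarith
  have hu0 : 0 < u := zero_lt_one.trans_le hu1
  have hεu : 1 / ε ≤ u := by rw [hu]; exact div_le_div_of_nonneg_right hM1 hε0.le
  set r : ℝ := ε / (c₁ * M) with hr
  have hr0 : 0 < r := by positivity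
  have hrinv : 1 / r ^ 2 = c₁ ^ 2 * u ^ 2 := by
    rw [hr, hu]; field_simp
  -- `A`, `Q`, `K`
  set A : ℝ := 1 + (1 / (Real.pi ^ 2 * r ^ 2)) * Zc with hA
  have hA0 : 0 ≤ A := by positivity
  have hAle : A ≤ a₀ * u ^ 2 := by
    have hA' : A = 1 + (Zc * c₁ ^ 2 / Real.pi ^ 2) * u ^ 2 := by
      rw [hA]
      have : 1 / (Real.pi ^ 2 * r ^ 2) = (1 / r ^ 2) / Real.pi ^ 2 := by
        field_simp
      rw [this, hrinv]; ring
    rw [hA', ha₀]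
    exact one_add_mul_sq_le _ hu1
  set Q : ℝ := 4 * cI * A ^ (cI - 1) * Zc / (Real.pi ^ 2 * r ^ 2 * ε) with hQ
  have hQ0 : 0 ≤ Q := by positivity
  have hQle : Q ≤ q₀ * u ^ e₁ := by
    have hQ' : Q = 4 * cI * A ^ (cI - 1) * Zc * (c₁ ^ 2 * u ^ 2) / Real.pi ^ 2 * (1 / ε) := by
      rw [hQ, ← hrinv]; field_simp
    rw [hQ']
    have h1 : A ^ (cI - 1) ≤ (a₀ * u ^ 2) ^ (cI - 1) := pow_le_pow_left₀ hA0 hAle _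
    calc 4 * cI * A ^ (cI - 1) * Zc * (c₁ ^ 2 * u ^ 2) / Real.pi ^ 2 * (1 / ε)
        ≤ 4 * cI * (a₀ * u ^ 2) ^ (cI - 1) * Zc * (c₁ ^ 2 * u ^ 2) / Real.pi ^ 2 * u := by
          gcongr
      _ = q₀ * u ^ e₁ := by
          rw [hq₀, he₁, mul_pow, ← pow_mul]; ring
  set K : ℕ := ⌈Q ^ 2⌉₊ with hK
  have hKQ : Q ^ 2 ≤ K := Nat.le_ceil _
  have hK1 : (K : ℝ) + 1 ≤ (q₀ ^ 2 + 2) * u ^ (2 * e₁) := by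
    have h1 : (K : ℝ) < Q ^ 2 + 1 := Nat.ceil_lt_add_one (sq_nonneg Q)
    have h2 : Q ^ 2 ≤ q₀ ^ 2 * u ^ (2 * e₁) := by
      calc Q ^ 2 ≤ (q₀ * u ^ e₁) ^ 2 := pow_le_pow_left₀ hQ0 hQle 2
        _ = q₀ ^ 2 * u ^ (2 * e₁) := by rw [mul_pow, ← pow_mul, mul_comm e₁ 2]
    have h3 : (1 : ℝ) ≤ u ^ (2 * e₁) := one_le_pow₀ hu1
    nlinarith [h1, h2, h3, sq_nonneg q₀]
  -- the two error terms
  have herr1 : M * L * r + L * M * L * r = ε / 4 := by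
    rw [hr, hc₁]; field_simp
  have hK0 : (0 : ℝ) < (K : ℝ) + 1 := by positivity
  have hQK : Q * ((K : ℝ) + 1) ^ (-(1 / 2 : ℝ)) ≤ 1 := by
    rw [Real.rpow_neg hK0.le, ← Real.sqrt_eq_rpow, ← div_eq_mul_inv,
      div_le_one (Real.sqrt_pos.mpr hK0)]
    calc Q = Real.sqrt (Q ^ 2) := (Real.sqrt_sq hQ0).symm
      _ ≤ Real.sqrt ((K : ℝ) + 1) := Real.sqrt_le_sqrt (by linarith [hKQ])
  have hrne : r ≠ 0 := hr0.ne'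
  have hεne : ε ≠ 0 := hε0.ne'
  have hπne : Real.pi ^ 2 ≠ 0 := by positivity
  have herr2 : (Fintype.card I : ℝ) * A ^ (Fintype.card I - 1) *
      ((1 / (Real.pi ^ 2 * r ^ 2)) * ((K : ℝ) + 1) ^ (-(1 / 2 : ℝ)) * Zc) ≤ ε / 4 := by
    have hrew : (Fintype.card I : ℝ) * A ^ (Fintype.card I - 1) *
        ((1 / (Real.pi ^ 2 * r ^ 2)) * ((K : ℝ) + 1) ^ (-(1 / 2 : ℝ)) * Zc) =
        (ε / 4 * Q) * ((K : ℝ) + 1) ^ (-(1 / 2 : ℝ)) := by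
      have hq : ε / 4 * Q = (cI : ℝ) * A ^ (cI - 1) * Zc / (Real.pi ^ 2 * r ^ 2) := by
        rw [hQ]; field_simp
      rw [hq, hcI]; ring
    rw [hrew, mul_assoc]
    calc ε / 4 * (Q * ((K : ℝ) + 1) ^ (-(1 / 2 : ℝ))) ≤ ε / 4 * 1 :=
          mul_le_mul_of_nonneg_left hQK (by positivity)
      _ = ε / 4 := mul_one _
  -- the box, its count, its enumeration
  set Box : Finset (I → ℤ) := Fintype.piFinset fun _ : I => Finset.Icc (-(K : ℤ)) K with hBox
  set n : ℕ := Box.card with hn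
  have hcount : (n : ℝ) ≤ (2 * (q₀ ^ 2 + 2)) ^ cI * M ^ (2 * e₁ * cI) / ε ^ (2 * e₁ * cI) := by
    have hcard : (n : ℝ) = (2 * (K : ℝ) + 1) ^ cI := by rw [hn, hBox, card_box]
    rw [hcard, le_div_iff₀ (pow_pos hε0 _)]
    have h2K : 2 * (K : ℝ) + 1 ≤ 2 * (q₀ ^ 2 + 2) * u ^ (2 * e₁) := by linarith [hK1]
    calc (2 * (K : ℝ) + 1) ^ cI * ε ^ (2 * e₁ * cI)
        ≤ (2 * (q₀ ^ 2 + 2) * u ^ (2 * e₁)) ^ cI * ε ^ (2 * e₁ * cI) := by gcongr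
      _ = (2 * (q₀ ^ 2 + 2)) ^ cI * (u ^ (2 * e₁ * cI) * ε ^ (2 * e₁ * cI)) := by
          rw [mul_pow, ← pow_mul]; ring
      _ = (2 * (q₀ ^ 2 + 2)) ^ cI * M ^ (2 * e₁ * cI) := by
          rw [← mul_pow, hu, div_mul_cancel₀ _ hεne]
  set e := Box.equivFin with he
  refine ⟨n, fun _ => 1,
    fun j x => (UnitAddTorus.mFourierCoeff (fun τ : UnitAddTorus I => (((∫ σ : UnitAddTorus I, ∫ σ' : UnitAddTorus I, F (ι (fun i => r * (AddCircle.equivIco (1 : ℝ) 0 (σ' i) : ℝ)) • (ι (fun i => r * (AddCircle.equivIco (1 : ℝ) 0 (σ i) : ℝ)) • (ι (fun i => (AddCircle.equivIco (1 : ℝ) 0 (τ i) : ℝ)) • x))) ∂(Measure.pi fun _ : I => AddCircle.haarAddCircle) ∂(Measure.pi fun _ : I => AddCircle.haarAddCircle)) : ℝ) : ℂ)) ((e.symm j : ↥Box) : I → ℤ)).re,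
    fun j x => (UnitAddTorus.mFourierCoeff (fun τ : UnitAddTorus I => (((∫ σ : UnitAddTorus I, ∫ σ' : UnitAddTorus I, F (ι (fun i => r * (AddCircle.equivIco (1 : ℝ) 0 (σ' i) : ℝ)) • (ι (fun i => r * (AddCircle.equivIco (1 : ℝ) 0 (σ i) : ℝ)) • (ι (fun i => (AddCircle.equivIco (1 : ℝ) 0 (τ i) : ℝ)) • x))) ∂(Measure.pi fun _ : I => AddCircle.haarAddCircle) ∂(Measure.pi fun _ : I => AddCircle.haarAddCircle)) : ℝ) : ℂ)) ((e.symm j : ↥Box) : I → ℤ)).im,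
    ?_, fun j => by simp, fun j => ?_, fun j => ?_, fun j => ?_, fun x => ?_⟩
  · exact hcount
  · exact (components_boundedLipschitz Y ι hadd hcen hΓ hcont hM0 hL.le hlip hF r _).1
  · exact (components_boundedLipschitz Y ι hadd hcen hΓ hcont hM0 hL.le hlip hF r _).2
  · exact components_isVertical Y ι hadd hcen hΓ hsurj F r _
  · -- the approximation
    have happ := norm_sub_sum_box_le Y ι hadd hcen hΓ hcont hM0 hL.le hlip hself hF hr0.le hr0.ne' K x
    -- rewrite the `Fin n`-indexed sum as the sum over the box
    have hsum : ∑ j : Fin n, (1 : ℂ) *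
        ((((UnitAddTorus.mFourierCoeff (fun τ : UnitAddTorus I => (((∫ σ : UnitAddTorus I, ∫ σ' : UnitAddTorus I, F (ι (fun i => r * (AddCircle.equivIco (1 : ℝ) 0 (σ' i) : ℝ)) • (ι (fun i => r * (AddCircle.equivIco (1 : ℝ) 0 (σ i) : ℝ)) • (ι (fun i => (AddCircle.equivIco (1 : ℝ) 0 (τ i) : ℝ)) • x))) ∂(Measure.pi fun _ : I => AddCircle.haarAddCircle) ∂(Measure.pi fun _ : I => AddCircle.haarAddCircle)) : ℝ) : ℂ)) ((e.symm j : ↥Box) : I → ℤ)).re : ℝ) : ℂ) +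
          (((UnitAddTorus.mFourierCoeff (fun τ : UnitAddTorus I => (((∫ σ : UnitAddTorus I, ∫ σ' : UnitAddTorus I, F (ι (fun i => r * (AddCircle.equivIco (1 : ℝ) 0 (σ' i) : ℝ)) • (ι (fun i => r * (AddCircle.equivIco (1 : ℝ) 0 (σ i) : ℝ)) • (ι (fun i => (AddCircle.equivIco (1 : ℝ) 0 (τ i) : ℝ)) • x))) ∂(Measure.pi fun _ : I => AddCircle.haarAddCircle) ∂(Measure.pi fun _ : I => AddCircle.haarAddCircle)) : ℝ) : ℂ)) ((e.symm j : ↥Box) : I → ℤ)).im : ℝ) : ℂ) * Complex.I) =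
        ∑ m ∈ Box, UnitAddTorus.mFourierCoeff (fun τ : UnitAddTorus I => (((∫ σ : UnitAddTorus I, ∫ σ' : UnitAddTorus I, F (ι (fun i => r * (AddCircle.equivIco (1 : ℝ) 0 (σ' i) : ℝ)) • (ι (fun i => r * (AddCircle.equivIco (1 : ℝ) 0 (σ i) : ℝ)) • (ι (fun i => (AddCircle.equivIco (1 : ℝ) 0 (τ i) : ℝ)) • x))) ∂(Measure.pi fun _ : I => AddCircle.haarAddCircle) ∂(Measure.pi fun _ : I => AddCircle.haarAddCircle)) : ℝ) : ℂ)) m := by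
      simp only [one_mul, Complex.re_add_im]
      rw [Equiv.sum_comp e.symm (fun m : ↥Box => UnitAddTorus.mFourierCoeff (fun τ : UnitAddTorus I => (((∫ σ : UnitAddTorus I, ∫ σ' : UnitAddTorus I, F (ι (fun i => r * (AddCircle.equivIco (1 : ℝ) 0 (σ' i) : ℝ)) • (ι (fun i => r * (AddCircle.equivIco (1 : ℝ) 0 (σ i) : ℝ)) • (ι (fun i => (AddCircle.equivIco (1 : ℝ) 0 (τ i) : ℝ)) • x))) ∂(Measure.pi fun _ : I => AddCircle.haarAddCircle) ∂(Measure.pi fun _ : I => AddCircle.haarAddCircle)) : ℝ) : ℂ)) (m : I → ℤ)), Finset.sum_coe_sort]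
    rw [hsum]
    refine happ.trans ?_
    clear hsum happ
    rw [herr1]
    have hε4 : ε / 4 + ε / 4 ≤ ε := by linarith
    exact (add_le_add le_rfl herr2).trans hε4

end Summit.Parity.GeneralizedHardyLittlewood.GreenTaoLevelTwoMNTwoVerticalHapprox
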